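/-
COR-CM (cell pub-hodgecm2, stage 2 of the Hodge ladder) — count-neutral KERNEL COMBINATORICS «the index-two cyclic law» (modular ∪ semidihedral
columns), part VII: THE GROUPS `ℤ/2n ⋊_r ℤ/2` REALISED — the datum on Mathlibʼs semidirect product, and the semidihedral-type and modular-type laws on
concrete groups (seat prover-pub-hodgecm2-b23-g49-0, binder prover b23, gen 49; claim «INDEX-TWO CYCLIC LAW», HOME/INBOX.md l.22678).  Bookkeeping
definitions (`mulAutOfSq`, `homOfInvolutive`, the type abbreviation `SplitGroup`, its `Fintype`/`DecidableEq` instances, `splitDatum`) + theorems, on parts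
I–VI and Mathlibʼs `SemidirectProduct`; no `decide` beyond closed identities in `ZMod 2`, no certificate, no named fact, no `sorry`; `Interfaces.lean` (C1),
every E term, B01, `Transposition/*`, `PortJoin/*`, `D2Bridge/*` untouched.
HONEST FRAMING: `HC_CM` is NOT proved, here or anywhere in the tree; nothing here is a period, a count of record or a headline.
T5: this file IS the inhabitation of the hypothesis binders of part VI: the datum exists on `ℤ/2n ⋊_r ℤ/2` for every `r` with `r² = 1`, and the twist
hypothesis `c ∈ ⟨u^{r+1}⟩` holds for `r = n − 1` (`n` even: semidihedral type, `SD_{4n}` for `n = 2^k`) and `r = n + 1` (`4 ∣ n`: modular type, `M_{4n}`).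
-/
import Summits.HodgeConjecture.CorCM.Census.IndexTwoCyclicLaw
import Summits.HodgeConjecture.CorCM.Census.IndexTwoCyclicBlockCount

/-!
# The index-two cyclic law, VII: the groups `ℤ/2n ⋊_r ℤ/2` and the semidihedral / modular laws on concrete groups

* §1 `mulAutOfSq r hr` — multiplication by `r` (`r·r = 1`) as an automorphism of `Multiplicative (ℤ/m)`; `homOfInvolutive` — the action of
  `Multiplicative (ℤ/2)` through an involutive automorphism; **`SplitGroup n r hr = Multiplicative (ℤ/2n) ⋊ Multiplicative (ℤ/2)`**, a finite group
  of order `4n` with decidable equality.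
* §2 **the datum** `splitDatum n r hr : Datum (SplitGroup n r hr) c n` with `u = (1, 0)`, `w = (0, 1)`, `c = (n, 0)`, twist `r.val`
  (`w·u = uʳ·w` is Mathlibʼs `SemidirectProduct.inl_aut`); `c·c = 1`, `c ≠ 1`.
* §3 **SEMIDIHEDRAL TYPE** `r = n − 1`, `n` even (`SD₁₆ = SplitGroup 4 3`, `SD₃₂ = SplitGroup 8 7`, …; also `ℤ/2n ⋊_{n−1} ℤ/2` for every even `n`):
  `u^{r+1} = uⁿ = c`, so part VI gives **`μ = β − 1 = φ₂`** (`isLeast_card_gfaces_generate_semidihedralType`, `…_fibreTwo`).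
* §4 **MODULAR TYPE** `r = n + 1`, `4 ∣ n` (`M₁₆ = SplitGroup 4 5`, `M₃₂ = SplitGroup 8 9`, …): `(u^{n+2})^{n/2} = c`, so **`μ = β − 1 = φ₂`**
  (`isLeast_card_gfaces_generate_modularType`, `…_fibreTwo`).
* §5 ROWS (part VIII BY NAME): `SD₁₆` `β = 20`, **`μ = 19`**; `M₁₆` `β = 18`, **`μ = 17`**; `SD₃₂` `β = 2112`, **`μ = 2111`**; `M₃₂` `β = 2064`, **`μ = 2063`**.
Nothing here is a period; `HC_CM` is NOT proved.

## References
* [Pohlmann1968] H. Pohlmann, Algebraic cycles on abelian varieties of complex multiplication type, Ann. of Math. 88 (1968), Thm 1.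
* [Milne1999] J. S. Milne, Lefschetz motives and the Tate conjecture, Compositio Math. 117 (1999), Prop. 2.1, p. 54.
-/

namespace Summit.HodgeConjecture.CorCM.Census.IndexTwoCyclic

open Finset
open Summit.HodgeConjecture.CorCM.Prior.AllgGroup.RfwfAllgGroup
open Summit.HodgeConjecture.CorCM.Census.BlockParity
open Summit.HodgeConjecture.CorCM.Census.Coinvariant

/-! ## §1 The groups `ℤ/2n ⋊_r ℤ/2` -/

section Construction

variable {m : ℕ}

/-- **Multiplication by `r`** (`r·r = 1`) as an automorphism of `Multiplicative (ℤ/m)`. [folklore] -/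
def mulAutOfSq (r : ZMod m) (hr : r * r = 1) : MulAut (Multiplicative (ZMod m)) where
  toFun x := Multiplicative.ofAdd (r * x.toAdd)
  invFun x := Multiplicative.ofAdd (r * x.toAdd)
  left_inv x := by simp [← mul_assoc, hr]
  right_inv x := by simp [← mul_assoc, hr]
  map_mul' x y := by simp [mul_add]

/-- The value of `mulAutOfSq`. [folklore] -/
@[simp] theorem mulAutOfSq_apply (r : ZMod m) (hr : r * r = 1) (x : Multiplicative (ZMod m)) :
    mulAutOfSq r hr x = Multiplicative.ofAdd (r * x.toAdd) := rfl

/-- `mulAutOfSq r` is an involution. [folklore] -/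
theorem mulAutOfSq_mul_self (r : ZMod m) (hr : r * r = 1) : mulAutOfSq r hr * mulAutOfSq r hr = 1 := by
  ext x
  change mulAutOfSq r hr (mulAutOfSq r hr x) = x
  rw [mulAutOfSq_apply, mulAutOfSq_apply, toAdd_ofAdd, ← mul_assoc, hr, one_mul, ofAdd_toAdd]

/-- **The action of `Multiplicative (ℤ/2)` through an involutive automorphism.** [folklore] -/
def homOfInvolutive {N : Type*} [Group N] (τ : MulAut N) (hτ : τ * τ = 1) : Multiplicative (ZMod 2) →* MulAut N where
  toFun z := if z.toAdd = 0 then 1 else τ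
  map_one' := by simp
  map_mul' a b := by
    have h01 : ∀ z : ZMod 2, z = 0 ∨ z = 1 := by decide
    have h11 : (1 : ZMod 2) + 1 = 0 := by decide
    rcases h01 a.toAdd with ha | ha <;> rcases h01 b.toAdd with hb | hb <;>
      simp [toAdd_mul, ha, hb, h11, hτ]

/-- The generator acts by `τ`. [folklore] -/
theorem homOfInvolutive_ofAdd_one {N : Type*} [Group N] (τ : MulAut N) (hτ : τ * τ = 1) :
    homOfInvolutive τ hτ (Multiplicative.ofAdd 1) = τ := by
  have h10 : (1 : ZMod 2) ≠ 0 := by decide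
  simp [homOfInvolutive, h10]

end Construction

/-- **THE GROUP `ℤ/2n ⋊_r ℤ/2`** (`r·r = 1`): `ℤ/2n × ℤ/2` (`r = 1`), the dihedral group (`r = −1`), the semidihedral-type group (`r = n − 1`) and
the modular-type group (`r = n + 1`). [folklore] -/
abbrev SplitGroup (n : ℕ) (r : ZMod (2 * n)) (hr : r * r = 1) : Type :=
  Multiplicative (ZMod (2 * n)) ⋊[homOfInvolutive (mulAutOfSq r hr) (mulAutOfSq_mul_self r hr)] Multiplicative (ZMod 2)

variable (n : ℕ) [NeZero n] (r : ZMod (2 * n)) (hr : r * r = 1)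

/-- `ℤ/2n ⋊_r ℤ/2` is finite. [folklore] -/
noncomputable instance instFintypeSplitGroup : Fintype (SplitGroup n r hr) := Fintype.ofEquiv _ SemidirectProduct.equivProd.symm

/-- `ℤ/2n ⋊_r ℤ/2` has decidable equality. [folklore] -/
instance instDecidableEqSplitGroup : DecidableEq (SplitGroup n r hr) := SemidirectProduct.equivProd.decidableEq

/-! ## §2 The datum -/

/-- **THE DATUM on `ℤ/2n ⋊_r ℤ/2`**: `u = (1, 0)`, `w = (0, 1)`, `c = (n, 0)`, twist `r.val`. [folklore] -/
noncomputable def splitDatum :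
    Datum (SplitGroup n r hr) (SemidirectProduct.inl (Multiplicative.ofAdd ((n : ℕ) : ZMod (2 * n)))) n where
  u := SemidirectProduct.inl (Multiplicative.ofAdd 1)
  w := SemidirectProduct.inr (Multiplicative.ofAdd 1)
  r := r.val
  hun := by rw [← map_pow, ← ofAdd_nsmul, nsmul_one]
  hord := by
    rw [orderOf_injective SemidirectProduct.inl SemidirectProduct.inl_injective, orderOf_ofAdd_eq_addOrderOf, ZMod.addOrderOf_one]
  hindex := by
    have h := (Subgroup.zpowers (SemidirectProduct.inl (Multiplicative.ofAdd (1 : ZMod (2 * n))) : SplitGroup n r hr)).card_mul_index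
    rw [Nat.card_zpowers, orderOf_injective SemidirectProduct.inl SemidirectProduct.inl_injective, orderOf_ofAdd_eq_addOrderOf,
      ZMod.addOrderOf_one, SemidirectProduct.card, Nat.card_eq_fintype_card, Nat.card_eq_fintype_card, Fintype.card_multiplicative,
      Fintype.card_multiplicative, ZMod.card, ZMod.card] at h
    have hn : 0 < 2 * n := by have := NeZero.ne n; omega
    exact Nat.eq_of_mul_eq_mul_left hn h
  hw := by
    intro h
    obtain ⟨k, hk⟩ := Subgroup.mem_zpowers_iff.mp h
    have h2 := congrArg SemidirectProduct.rightHom hk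
    rw [map_zpow, SemidirectProduct.rightHom_inl, one_zpow, SemidirectProduct.rightHom_inr] at h2
    have h3 : (0 : ZMod 2) = 1 := congrArg Multiplicative.toAdd h2
    exact absurd h3 (by decide)
  hww := by
    rw [← map_mul, ← ofAdd_add, show (1 : ZMod 2) + 1 = 0 by decide, ofAdd_zero, map_one]
  htwist := by
    have e : (SemidirectProduct.inl (Multiplicative.ofAdd (1 : ZMod (2 * n))) : SplitGroup n r hr) ^ r.val =
        SemidirectProduct.inl (Multiplicative.ofAdd r) := by
      rw [← map_pow, ← ofAdd_nsmul, nsmul_one, ZMod.natCast_zmod_val]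
    rw [e]
    ext
    · simp [homOfInvolutive_ofAdd_one]
    · simp

omit [NeZero n] in
/-- `c·c = 1` on `ℤ/2n ⋊_r ℤ/2`. [folklore] -/
theorem splitC_mul_self :
    (SemidirectProduct.inl (Multiplicative.ofAdd ((n : ℕ) : ZMod (2 * n))) : SplitGroup n r hr) *
      SemidirectProduct.inl (Multiplicative.ofAdd ((n : ℕ) : ZMod (2 * n))) = 1 := by
  rw [← map_mul, ← ofAdd_add, ← Nat.cast_add, ← two_mul, ZMod.natCast_self, ofAdd_zero, map_one]

/-- `c ≠ 1` on `ℤ/2n ⋊_r ℤ/2` (`n ≠ 0` in `ℤ/2n`). [folklore] -/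
theorem splitC_ne_one : (SemidirectProduct.inl (Multiplicative.ofAdd ((n : ℕ) : ZMod (2 * n))) : SplitGroup n r hr) ≠ 1 := by
  intro h
  have h1 : Multiplicative.ofAdd ((n : ℕ) : ZMod (2 * n)) = 1 :=
    SemidirectProduct.inl_injective (by rwa [map_one])
  have h2 : ((n : ℕ) : ZMod (2 * n)) = 0 := by
    have := congrArg Multiplicative.toAdd h1
    rwa [toAdd_ofAdd, toAdd_one] at this
  have h3 := congrArg ZMod.val h2
  rw [TwistGeneration.val_n, ZMod.val_zero] at h3
  exact NeZero.ne n h3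

/-- The datum is inhabited on `ℤ/2n ⋊_r ℤ/2` (T5). [folklore] -/
theorem nonempty_datum : Nonempty (Datum (SplitGroup n r hr) (SemidirectProduct.inl (Multiplicative.ofAdd ((n : ℕ) : ZMod (2 * n)))) n) :=
  ⟨splitDatum n r hr⟩

/-- **`μ ≤ β − 1` on EVERY `ℤ/2n ⋊_r ℤ/2`** (part V on the concrete group). [folklore] -/
theorem exists_gfaces_generate_splitGroup :
    ∃ S : Finset (CMF (SplitGroup n r hr) (SemidirectProduct.inl (Multiplicative.ofAdd ((n : ℕ) : ZMod (2 * n)))) →₀ ℤ),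
      (↑S ⊆ gfaceSet (SplitGroup n r hr) _ (splitC_mul_self n r hr)) ∧
      S.card + 1 ≤ Fintype.card (Block (SemidirectProduct.inl (Multiplicative.ofAdd ((n : ℕ) : ZMod (2 * n))) : SplitGroup n r hr)) ∧
      hodgeSpan _ (splitC_mul_self n r hr) ≤ Submodule.span ℤ (pairSet _) ⊔ Submodule.span ℤ (translates _ S) :=
  exists_gfaces_generate (splitDatum n r hr) (splitC_mul_self n r hr)

omit [NeZero n] in
/-- `n·n = 0` and `2·n = 0` in `ℤ/2n` for even `n`. [folklore] -/
theorem natCast_n_mul_self_of_even (hn : Even n) :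
    (n : ZMod (2 * n)) * (n : ZMod (2 * n)) = 0 ∧ (2 : ZMod (2 * n)) * (n : ZMod (2 * n)) = 0 := by
  obtain ⟨k, hk⟩ := hn
  constructor
  · have e : (n * n : ℕ) = (2 * n) * k := by rw [hk]; ring
    rw [← Nat.cast_mul, e, Nat.cast_mul, ZMod.natCast_self, zero_mul]
  · have e : ((2 : ℕ) : ZMod (2 * n)) * (n : ZMod (2 * n)) = 0 := by rw [← Nat.cast_mul, ZMod.natCast_self]
    rwa [Nat.cast_ofNat] at e

/-! ## §3 Semidihedral type: `r = n − 1`, `n` even -/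

omit [NeZero n] in
/-- `(n − 1)·(n − 1) = 1` in `ℤ/2n` for even `n`. [folklore] -/
theorem sdTwist_sq (hn : Even n) : ((n : ZMod (2 * n)) - 1) * ((n : ZMod (2 * n)) - 1) = 1 := by
  obtain ⟨h1, h2⟩ := natCast_n_mul_self_of_even n hn
  calc ((n : ZMod (2 * n)) - 1) * ((n : ZMod (2 * n)) - 1) = (n : ZMod (2 * n)) * n - 2 * n + 1 := by ring
    _ = 1 := by rw [h1, h2, sub_zero, zero_add]

/-- **THE SEMIDIHEDRAL-TYPE GROUP** `ℤ/2n ⋊_{n−1} ℤ/2` (`n` even): `SD₁₆` (`n = 4`), `SD₃₂` (`n = 8`), `SD_{2^{k}}` (`n = 2^{k−2}`), and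
`ℤ/2n ⋊_{n−1} ℤ/2` for every even `n`. [folklore] -/
abbrev SDType (hn : Even n) : Type := SplitGroup n ((n : ZMod (2 * n)) - 1) (sdTwist_sq n hn)

/-- On the semidihedral-type group the twist hypothesis holds: `u^{r+1} = uⁿ = c`. [folklore] -/
theorem c_mem_zpowers_twist_sd (hn : Even n) :
    (SemidirectProduct.inl (Multiplicative.ofAdd ((n : ℕ) : ZMod (2 * n))) : SDType n hn) ∈
      Subgroup.zpowers ((splitDatum n ((n : ZMod (2 * n)) - 1) (sdTwist_sq n hn)).u ^
        ((splitDatum n ((n : ZMod (2 * n)) - 1) (sdTwist_sq n hn)).r + 1)) := by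
  have hr : (splitDatum n ((n : ZMod (2 * n)) - 1) (sdTwist_sq n hn)).r + 1 = n := by
    change ((n : ZMod (2 * n)) - 1).val + 1 = n
    rw [QuaternionColumn.val_sub_one_of_ne (QuaternionColumn.natCast_n_ne_zero (n := n)), TwistGeneration.val_n]
    have := NeZero.ne n
    omega
  rw [hr, (splitDatum n ((n : ZMod (2 * n)) - 1) (sdTwist_sq n hn)).hun]
  exact Subgroup.mem_zpowers _

/-- **THE SEMIDIHEDRAL-TYPE LAW `μ = β − 1`** on `ℤ/2n ⋊_{n−1} ℤ/2`, `n` even (`SD₁₆: 19 = 20 − 1`, `SD₃₂: 2111`). [folklore] -/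
theorem isLeast_card_gfaces_generate_semidihedralType (hn : Even n) :
    IsLeast {m : ℕ | ∃ S : Finset (CMF (SDType n hn) (SemidirectProduct.inl (Multiplicative.ofAdd ((n : ℕ) : ZMod (2 * n)))) →₀ ℤ),
      ↑S ⊆ gfaceSet (SDType n hn) _ (splitC_mul_self n _ (sdTwist_sq n hn)) ∧ S.card = m ∧
      hodgeSpan _ (splitC_mul_self n _ (sdTwist_sq n hn)) ≤ Submodule.span ℤ (pairSet _) ⊔ Submodule.span ℤ (translates _ S)}
      (Fintype.card (Block (SemidirectProduct.inl (Multiplicative.ofAdd ((n : ℕ) : ZMod (2 * n))) : SDType n hn)) - 1) :=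
  isLeast_card_gfaces_generate_of_twist (splitDatum n _ (sdTwist_sq n hn)) (splitC_mul_self n _ _) (splitC_ne_one n _ _) hn
    (c_mem_zpowers_twist_sd n hn)

/-- **`μ = φ₂` on the semidihedral-type group.** [folklore] -/
theorem isLeast_card_gfaces_generate_fibreTwo_semidihedralType (hn : Even n) :
    IsLeast {m : ℕ | ∃ S : Finset (CMF (SDType n hn) (SemidirectProduct.inl (Multiplicative.ofAdd ((n : ℕ) : ZMod (2 * n)))) →₀ ℤ),
      ↑S ⊆ gfaceSet (SDType n hn) _ (splitC_mul_self n _ (sdTwist_sq n hn)) ∧ S.card = m ∧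
      hodgeSpan _ (splitC_mul_self n _ (sdTwist_sq n hn)) ≤ Submodule.span ℤ (pairSet _) ⊔ Submodule.span ℤ (translates _ S)}
      (fibreTwo (SemidirectProduct.inl (Multiplicative.ofAdd ((n : ℕ) : ZMod (2 * n))) : SDType n hn) (splitC_mul_self n _ (sdTwist_sq n hn))) :=
  isLeast_card_gfaces_generate_fibreTwo_of_twist (splitDatum n _ (sdTwist_sq n hn)) (splitC_mul_self n _ _) (splitC_ne_one n _ _) hn
    (c_mem_zpowers_twist_sd n hn)

/-- **`β = φ₂ + 1` on the semidihedral-type group.** [folklore] -/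
theorem card_block_eq_fibreTwo_add_one_semidihedralType (hn : Even n) :
    Fintype.card (Block (SemidirectProduct.inl (Multiplicative.ofAdd ((n : ℕ) : ZMod (2 * n))) : SDType n hn)) =
      fibreTwo (SemidirectProduct.inl (Multiplicative.ofAdd ((n : ℕ) : ZMod (2 * n))) : SDType n hn) (splitC_mul_self n _ (sdTwist_sq n hn)) + 1 :=
  card_block_eq_fibreTwo_add_one_of_twist (splitDatum n _ (sdTwist_sq n hn)) (splitC_mul_self n _ _) (splitC_ne_one n _ _) hn
    (c_mem_zpowers_twist_sd n hn)

/-! ## §4 Modular type: `r = n + 1`, `4 ∣ n` -/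

omit [NeZero n] in
/-- `(n + 1)·(n + 1) = 1` in `ℤ/2n` for even `n`. [folklore] -/
theorem mTwist_sq (hn : Even n) : ((n : ZMod (2 * n)) + 1) * ((n : ZMod (2 * n)) + 1) = 1 := by
  obtain ⟨h1, h2⟩ := natCast_n_mul_self_of_even n hn
  calc ((n : ZMod (2 * n)) + 1) * ((n : ZMod (2 * n)) + 1) = (n : ZMod (2 * n)) * n + 2 * n + 1 := by ring
    _ = 1 := by rw [h1, h2, add_zero, zero_add]

omit [NeZero n] in
/-- `4 ∣ n` implies `n` even. [folklore] -/
theorem even_of_four_dvd (h4 : 4 ∣ n) : Even n := by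
  obtain ⟨k, rfl⟩ := h4
  exact ⟨2 * k, by ring⟩

/-- **THE MODULAR-TYPE GROUP** `ℤ/2n ⋊_{n+1} ℤ/2` (`4 ∣ n`): `M₁₆` (`n = 4`), `M₃₂` (`n = 8`), `M_{2^k}` (`n = 2^{k−2}`). [folklore] -/
abbrev MType (h4 : 4 ∣ n) : Type := SplitGroup n ((n : ZMod (2 * n)) + 1) (mTwist_sq n (even_of_four_dvd n h4))

/-- On the modular-type group the twist hypothesis holds: `(u^{n+2})^{n/4·2} = c` — precisely `u^{(n+2)·(n/2)} = u^{2n·(n/4) + n} = c`. [folklore] -/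
theorem c_mem_zpowers_twist_m (h4 : 4 ∣ n) :
    (SemidirectProduct.inl (Multiplicative.ofAdd ((n : ℕ) : ZMod (2 * n))) : MType n h4) ∈
      Subgroup.zpowers ((splitDatum n ((n : ZMod (2 * n)) + 1) (mTwist_sq n (even_of_four_dvd n h4))).u ^
        ((splitDatum n ((n : ZMod (2 * n)) + 1) (mTwist_sq n (even_of_four_dvd n h4))).r + 1)) := by
  set D := splitDatum n ((n : ZMod (2 * n)) + 1) (mTwist_sq n (even_of_four_dvd n h4)) with hD
  obtain ⟨k, hk⟩ := h4
  have hn0 := NeZero.ne n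
  have hr : D.r + 1 = n + 2 := by
    change ((n : ZMod (2 * n)) + 1).val + 1 = n + 2
    rw [ZMod.val_add, TwistGeneration.val_n, QuaternionColumn.val_one_eq, Nat.mod_eq_of_lt (by omega)]
  rw [hr, Subgroup.mem_zpowers_iff]
  refine ⟨((2 * k : ℕ) : ℤ), ?_⟩
  rw [zpow_natCast, ← pow_mul]
  have e : (n + 2) * (2 * k) = (2 * n) * k + n := by rw [hk]; ring
  rw [e, pow_add, pow_mul, D.pow_two_mul, one_pow, one_mul, D.hun]

/-- **THE MODULAR-TYPE LAW `μ = β − 1`** on `ℤ/2n ⋊_{n+1} ℤ/2`, `4 ∣ n` (`M₁₆: 17 = 18 − 1`, `M₃₂: 2063`). [folklore] -/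
theorem isLeast_card_gfaces_generate_modularType (h4 : 4 ∣ n) :
    IsLeast {m : ℕ | ∃ S : Finset (CMF (MType n h4) (SemidirectProduct.inl (Multiplicative.ofAdd ((n : ℕ) : ZMod (2 * n)))) →₀ ℤ),
      ↑S ⊆ gfaceSet (MType n h4) _ (splitC_mul_self n _ (mTwist_sq n (even_of_four_dvd n h4))) ∧ S.card = m ∧
      hodgeSpan _ (splitC_mul_self n _ (mTwist_sq n (even_of_four_dvd n h4))) ≤ Submodule.span ℤ (pairSet _) ⊔ Submodule.span ℤ (translates _ S)}
      (Fintype.card (Block (SemidirectProduct.inl (Multiplicative.ofAdd ((n : ℕ) : ZMod (2 * n))) : MType n h4)) - 1) :=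
  isLeast_card_gfaces_generate_of_twist (splitDatum n _ (mTwist_sq n (even_of_four_dvd n h4))) (splitC_mul_self n _ _)
    (splitC_ne_one n _ _) (even_of_four_dvd n h4) (c_mem_zpowers_twist_m n h4)

/-- **`μ = φ₂` on the modular-type group.** [folklore] -/
theorem isLeast_card_gfaces_generate_fibreTwo_modularType (h4 : 4 ∣ n) :
    IsLeast {m : ℕ | ∃ S : Finset (CMF (MType n h4) (SemidirectProduct.inl (Multiplicative.ofAdd ((n : ℕ) : ZMod (2 * n)))) →₀ ℤ),
      ↑S ⊆ gfaceSet (MType n h4) _ (splitC_mul_self n _ (mTwist_sq n (even_of_four_dvd n h4))) ∧ S.card = m ∧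
      hodgeSpan _ (splitC_mul_self n _ (mTwist_sq n (even_of_four_dvd n h4))) ≤ Submodule.span ℤ (pairSet _) ⊔ Submodule.span ℤ (translates _ S)}
      (fibreTwo (SemidirectProduct.inl (Multiplicative.ofAdd ((n : ℕ) : ZMod (2 * n))) : MType n h4)
        (splitC_mul_self n _ (mTwist_sq n (even_of_four_dvd n h4)))) :=
  isLeast_card_gfaces_generate_fibreTwo_of_twist (splitDatum n _ (mTwist_sq n (even_of_four_dvd n h4))) (splitC_mul_self n _ _)
    (splitC_ne_one n _ _) (even_of_four_dvd n h4) (c_mem_zpowers_twist_m n h4)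

/-- **`β = φ₂ + 1` on the modular-type group.** [folklore] -/
theorem card_block_eq_fibreTwo_add_one_modularType (h4 : 4 ∣ n) :
    Fintype.card (Block (SemidirectProduct.inl (Multiplicative.ofAdd ((n : ℕ) : ZMod (2 * n))) : MType n h4)) =
      fibreTwo (SemidirectProduct.inl (Multiplicative.ofAdd ((n : ℕ) : ZMod (2 * n))) : MType n h4)
        (splitC_mul_self n _ (mTwist_sq n (even_of_four_dvd n h4))) + 1 :=
  card_block_eq_fibreTwo_add_one_of_twist (splitDatum n _ (mTwist_sq n (even_of_four_dvd n h4))) (splitC_mul_self n _ _)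
    (splitC_ne_one n _ _) (even_of_four_dvd n h4) (c_mem_zpowers_twist_m n h4)

/-! ## §5 Rows: `SD₁₆`, `M₁₆`, `SD₃₂`, `M₃₂` -/

/-- **`SD₁₆ = ℤ/8 ⋊₃ ℤ/2`: `β = 20`.** [folklore] -/
theorem card_block_sd16 : Fintype.card (Block (SemidirectProduct.inl (Multiplicative.ofAdd ((4 : ℕ) : ZMod (2 * 4))) :
    SDType 4 ⟨2, rfl⟩)) = 20 :=
  card_block_eq_twenty (splitDatum 4 _ (sdTwist_sq 4 ⟨2, rfl⟩)) (splitC_mul_self 4 _ _) (splitC_ne_one 4 _ _) (by decide)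

/-- **`SD₁₆`: EXACTLY `19` face relations generate the Hodge lattice modulo pairs, none fewer.** [folklore] -/
theorem isLeast_card_gfaces_generate_sd16 :
    IsLeast {m : ℕ | ∃ S : Finset (CMF (SDType 4 ⟨2, rfl⟩) (SemidirectProduct.inl (Multiplicative.ofAdd ((4 : ℕ) : ZMod (2 * 4)))) →₀ ℤ),
      ↑S ⊆ gfaceSet (SDType 4 ⟨2, rfl⟩) _ (splitC_mul_self 4 _ (sdTwist_sq 4 ⟨2, rfl⟩)) ∧ S.card = m ∧
      hodgeSpan _ (splitC_mul_self 4 _ (sdTwist_sq 4 ⟨2, rfl⟩)) ≤ Submodule.span ℤ (pairSet _) ⊔ Submodule.span ℤ (translates _ S)} 19 := by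
  have h := isLeast_card_gfaces_generate_semidihedralType 4 ⟨2, rfl⟩
  rwa [card_block_sd16] at h

/-- **`M₁₆ = ℤ/8 ⋊₅ ℤ/2`: `β = 18`.** [folklore] -/
theorem card_block_m16 : Fintype.card (Block (SemidirectProduct.inl (Multiplicative.ofAdd ((4 : ℕ) : ZMod (2 * 4))) :
    MType 4 ⟨1, rfl⟩)) = 18 :=
  card_block_eq_eighteen (splitDatum 4 _ (mTwist_sq 4 (even_of_four_dvd 4 ⟨1, rfl⟩))) (splitC_mul_self 4 _ _) (splitC_ne_one 4 _ _)
    (by decide)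

/-- **`M₁₆`: EXACTLY `17` face relations generate the Hodge lattice modulo pairs, none fewer.** [folklore] -/
theorem isLeast_card_gfaces_generate_m16 :
    IsLeast {m : ℕ | ∃ S : Finset (CMF (MType 4 ⟨1, rfl⟩) (SemidirectProduct.inl (Multiplicative.ofAdd ((4 : ℕ) : ZMod (2 * 4)))) →₀ ℤ),
      ↑S ⊆ gfaceSet (MType 4 ⟨1, rfl⟩) _ (splitC_mul_self 4 _ (mTwist_sq 4 (even_of_four_dvd 4 ⟨1, rfl⟩))) ∧ S.card = m ∧
      hodgeSpan _ (splitC_mul_self 4 _ (mTwist_sq 4 (even_of_four_dvd 4 ⟨1, rfl⟩))) ≤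
        Submodule.span ℤ (pairSet _) ⊔ Submodule.span ℤ (translates _ S)} 17 := by
  have h := isLeast_card_gfaces_generate_modularType 4 ⟨1, rfl⟩
  rwa [card_block_m16] at h

/-- **`SD₃₂ = ℤ/16 ⋊₇ ℤ/2`: `β = 2112`.** [folklore] -/
theorem card_block_sd32 : Fintype.card (Block (SemidirectProduct.inl (Multiplicative.ofAdd ((8 : ℕ) : ZMod (2 * 8))) :
    SDType 8 ⟨4, rfl⟩)) = 2112 :=
  card_block_eq_2112 (splitDatum 8 _ (sdTwist_sq 8 ⟨4, rfl⟩)) (splitC_mul_self 8 _ _) (splitC_ne_one 8 _ _) (by decide)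

/-- **`SD₃₂`: EXACTLY `2111` face relations generate the Hodge lattice modulo pairs, none fewer.** [folklore] -/
theorem isLeast_card_gfaces_generate_sd32 :
    IsLeast {m : ℕ | ∃ S : Finset (CMF (SDType 8 ⟨4, rfl⟩) (SemidirectProduct.inl (Multiplicative.ofAdd ((8 : ℕ) : ZMod (2 * 8)))) →₀ ℤ),
      ↑S ⊆ gfaceSet (SDType 8 ⟨4, rfl⟩) _ (splitC_mul_self 8 _ (sdTwist_sq 8 ⟨4, rfl⟩)) ∧ S.card = m ∧
      hodgeSpan _ (splitC_mul_self 8 _ (sdTwist_sq 8 ⟨4, rfl⟩)) ≤ Submodule.span ℤ (pairSet _) ⊔ Submodule.span ℤ (translates _ S)} 2111 := by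
  have h := isLeast_card_gfaces_generate_semidihedralType 8 ⟨4, rfl⟩
  rwa [card_block_sd32] at h

/-- **`M₃₂ = ℤ/16 ⋊₉ ℤ/2`: `β = 2064`.** [folklore] -/
theorem card_block_m32 : Fintype.card (Block (SemidirectProduct.inl (Multiplicative.ofAdd ((8 : ℕ) : ZMod (2 * 8))) :
    MType 8 ⟨2, rfl⟩)) = 2064 :=
  card_block_eq_2064 (splitDatum 8 _ (mTwist_sq 8 (even_of_four_dvd 8 ⟨2, rfl⟩))) (splitC_mul_self 8 _ _) (splitC_ne_one 8 _ _)
    (by decide)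

/-- **`M₃₂`: EXACTLY `2063` face relations generate the Hodge lattice modulo pairs, none fewer.** [folklore] -/
theorem isLeast_card_gfaces_generate_m32 :
    IsLeast {m : ℕ | ∃ S : Finset (CMF (MType 8 ⟨2, rfl⟩) (SemidirectProduct.inl (Multiplicative.ofAdd ((8 : ℕ) : ZMod (2 * 8)))) →₀ ℤ),
      ↑S ⊆ gfaceSet (MType 8 ⟨2, rfl⟩) _ (splitC_mul_self 8 _ (mTwist_sq 8 (even_of_four_dvd 8 ⟨2, rfl⟩))) ∧ S.card = m ∧
      hodgeSpan _ (splitC_mul_self 8 _ (mTwist_sq 8 (even_of_four_dvd 8 ⟨2, rfl⟩))) ≤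
        Submodule.span ℤ (pairSet _) ⊔ Submodule.span ℤ (translates _ S)} 2063 := by
  have h := isLeast_card_gfaces_generate_modularType 8 ⟨2, rfl⟩
  rwa [card_block_m32] at h

end Summit.HodgeConjecture.CorCM.Census.IndexTwoCyclic
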